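import Mathlib
import HarnessLib
import Summits.HubbardSuperconductivity.HubbardSuperconductivity.Theorems.KLProgrammeKLRegimeVolumeLimitV11TowerDataOfSuppliers
import Summits.HubbardSuperconductivity.HubbardSuperconductivity.Theorems.KLProgrammeKLRegimeTwoVolumeTowerDataTSExists
import Summits.HubbardSuperconductivity.HubbardSuperconductivity.Theorems.KLProgrammeKLRegimeTwoVolumeTowerStepCovFlowAllSteps
import Summits.HubbardSuperconductivity.HubbardSuperconductivity.Theorems.KLProgrammeKLRegimeTwoVolumeTowerStepCovSecFlowAllSteps
import Summits.HubbardSuperconductivity.HubbardSuperconductivity.Theorems.KLProgrammeKLRegimeTwoVolumeTowerTransferAllSteps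
import Literature.MathematicalPhysics.QuantumLattice.GrassmannGramBoundedWeights
import Literature.MathematicalPhysics.QuantumLattice.HubbardMatsubaraTwoCutoffGram

/-!
# Route `KLProgramme` — crux K3, VL child `KLRegimeVolumeLimitV17F2` (stmt-HubbardSuperconductivity-20440), skeleton «cauchy» v11: THE `hSup` DISCHARGER,
# part 1 — p3's ALL-STEPS DOORS UNDER THE TOWER HYPOTHESIS, IN THE BINDER BLOCK `hinst` OF `exists_towerDataTS_of_readouts`
# (seat hubbard-kl-k3c4-p1 g16; `--supports` 20440)

`stub_vl_towerData` (v11) is `stub_vl_towerData_of_suppliers_pos hSup stub_vl_srcProfiles` (p638250); `hSup` is discharged by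
`…TowerDataTSExists.exists_towerDataTS_of_readouts` (p637313), whose binder block `hinst` asks — eventually in `L`, at every admissible instance `(L, b, M)`,
at the flow frames `K_V := klFlowFrameU V M β U μ (nScales β + 1)`, `V ∈ {L, b·L}` — for the `ScaleCovData` bundles of `klStepCov V M β μ K_V j`
(`j < n_β`, both volumes), and inside `TowerCrossData` for the bundle / sectional row of `klStepCov (b·L) M β μ K_L j` and the transfer bundle of
`klTowerTransfer (b·L) M β μ K_L j` (`j ≤ n_β`).  p3's three ALL-STEPS doors (`scaleCovData_klStepCov_flow_all`, `scaleCovSecData_klStepCov_flow_all`,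
`transferWtData_klTowerTransfer_flow_all`; steps `j ≥ 1`, resp. all `j` for the transfer) deliver exactly these, under the engine's regime binders and the
history `HistP klPredsV17F2 … 0 n`.  This file threads them to the VL stub's binders:

* §1 `scaleCovData_mono'` (monotone in the Gram constant, the row constant and the entry sup — one `κ`-law `κ_j² = k₀²·8^{−j}`, one `aW_j = a₀·4^j`, one `sW`
  for all steps INCLUDING the scale-0 lane's `j = 0`), `gramPath_of_scaleCovData` (`TowerCrossData.gramPath` from the two frames' bundles: `κf := κ′ + (κ″ + κ′)`,
  straight path by `isGramBoundedR_real_smul`);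
* §2 `histP_top_of_towerP` — `TowerP klPredsV17F2 G P Q R β U μ K Lstar Mstar`, `Lstar ≤ L`, `Mstar L ≤ M` ⇒ `HistP klPredsV17F2 L M G P Q R β U μ 0 (n_β+1)`
  (the V17F2 slots ignore the dummy frame);
* §3 the constants' laws: `√(Cκ·(Λ_k/Λ_{k+2})·klE0·8^{−k}) ≤ √(k₀²·8^{−k})` once `16·Cκ·klE0 ≤ k₀²`; `Cα·(M/β)/Λ_{k+2} ≤ a₀·4^k/ε_M` once `8·Cα/klE0 ≤ a₀`;
* §4 **`towerDoors_of_towerP`** — ONE set of absolute constants `(k₁, a₁, s₁, e₁, w₁, ρ)` such that, for `R.WF2`, `0 < c ≤ klEngC₃6 P R`, `μ ∈ klWindowC`,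
  `0 < U ≤ min (klEngU₀3 P R c) (1/(R.Gfr 3+1))`, `U ≤ klEngU₀4 P R c`, `klBetaMin ≤ β ≤ e^{c/U²}`, ANY `(K, Lstar, Mstar)` with the tower, any rate
  `0 ≤ Λ ≤ Λ_{n_β+1}` with `Λ·4^{n_β+1} ≤ ρ`, and every instance `L ≥ max Lstar (klEngL₃ β U)`, `M ≥ Mstar L, Mstar (bL), klEngM₃ β U L, klEngM₃ β U (bL)`:
  the five families above at the steps `1 ≤ j` (transfer: all `j ≤ n_β`) with `κ_j = √(k₁²·8^{−j})`, `αW_j = a₁·4^j/ε_M`, entry sup `s₁`, sectional `e₁`, `Cw = w₁`.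

What this does NOT supply (the suppliers' atoms, unchanged): the scale-0 lane's `j = 0` bundles / sectional row (p3 g17 «SCALE-0-STEPCOV»), E1's alive read-out
and slice partition functions, the frame-MISMATCH rates (k3c4-p2), the base bundle and `TowerGridDataD`.  LOCATED «VL-R-WF2»: the doors are stated under
`R.WF2` while the VL child's binder is `R.WF`; this file keeps `R.WF2` explicit (the K3 glue holds `R.WF2` from child 2, so the planner may re-key the child).

Proofs only; no definition.  Honest framing: quantifier/constant threading of landed finite-torus bounds; nothing here asserts any stub, K3, VL or superconductivity.
[cite: BenfattoGiulianiMastropietro2006, §2.7 (2.70)–(2.71a), §2.8 (2.80)–(2.81), §3 (3.2)–(3.8)]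
-/

noncomputable section

namespace Summit.HubbardSuperconductivity.HubbardSuperconductivity.Theorems.TwoVolumeSource

set_option linter.dupNamespace false -- summit = problem name (single-conjunct summit), D-0017

open Finset Filter Topology Literature.MathematicalPhysics.QuantumLattice GrassmannAlgebra Literature.Probability.LatticeModels
  Literature.Probability.LatticeModels.BattleFederbush
open Summit.HubbardSuperconductivity.HubbardSuperconductivity.Theorems.KLRegimeSplit
open Summit.HubbardSuperconductivity.HubbardSuperconductivity.Theorems.KLProgrammeLegKernels
open Summit.HubbardSuperconductivity.HubbardSuperconductivity.Theorems.TwoPointAssembly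
open Summit.HubbardSuperconductivity.HubbardSuperconductivity.Theorems.EngineV8
open Summit.HubbardSuperconductivity.HubbardSuperconductivity.Theorems.TwoVolumeDefect
open Summit.HubbardSuperconductivity.HubbardSuperconductivity.Theorems.TorusFourierL2

/-! ## §1 Generic: monotonicity of the bundle; the Gram path between two frames -/

/-- `ScaleCovData` is monotone in the Gram constant, the row constant and the entry sup. [cite: BenfattoGiulianiMastropietro2006, §2.8 (2.80)–(2.81)] -/
theorem scaleCovData_mono' {V M N : ℕ} [NeZero V] {C : Matrix (SpaceTimeIdx V M × SectorLeg N) (SpaceTimeIdx V M × SectorLeg N) ℂ}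
    {Λ κ κ' αW αW' sW sW' : ℝ} (h : ScaleCovData C Λ κ αW sW) (hκ : κ ≤ κ') (hα : αW ≤ αW') (hs : sW ≤ sW') : ScaleCovData C Λ κ' αW' sW' where
  κ_pos := h.κ_pos.trans_le hκ
  gram := IsGramBoundedR.mono h.gram h.κ_pos.le hκ
  αW_pos := h.αW_pos.trans_le hα
  row X := (h.row X).trans hα
  col Y := (h.col Y).trans hα
  sW_nonneg := h.sW_nonneg.trans hs
  entry X Y := (h.entry X Y).trans hs

/-- **The Gram path between two frames** (`TowerCrossData.gramPath`): from the bundles of the SAME step covariance at the coarse frame (`κ′`) and at the fine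
frame (`κ″`), `IsGramBoundedR (Cc + t • (Cf − Cc)) (κ′ + (κ″ + κ′))` for every `t ∈ [0,1]` (`IsGramBoundedR.add/.sub`, `isGramBoundedR_real_smul`).
[cite: BenfattoGiulianiMastropietro2006, §2.8 (2.80)] -/
theorem gramPath_of_scaleCovData {V M N : ℕ} [NeZero V] {Cc Cf : Matrix (SpaceTimeIdx V M × SectorLeg N) (SpaceTimeIdx V M × SectorLeg N) ℂ}
    {Λ Λ' κ' κ'' αW αW' sW sW' : ℝ} (hc : ScaleCovData Cc Λ κ' αW sW) (hf : ScaleCovData Cf Λ' κ'' αW' sW') :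
    ∀ t ∈ Set.Icc (0 : ℝ) 1, IsGramBoundedR (Cc + t • (Cf - Cc)) (κ' + (κ'' + κ')) := by
  intro t ht
  exact IsGramBoundedR.add hc.gram (isGramBoundedR_real_smul (IsGramBoundedR.sub hf.gram hc.gram hf.κ_pos.le) ht.1 ht.2) hc.κ_pos.le

/-- The Gram path constant is `≤ 3·max`: with ONE `κ`-law on both frames, `κ′ + (κ′ + κ′) = 3κ′`. [folklore] -/
theorem gramPath_of_scaleCovData_same {V M N : ℕ} [NeZero V] {Cc Cf : Matrix (SpaceTimeIdx V M × SectorLeg N) (SpaceTimeIdx V M × SectorLeg N) ℂ}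
    {Λ Λ' κ αW αW' sW sW' : ℝ} (hc : ScaleCovData Cc Λ κ αW sW) (hf : ScaleCovData Cf Λ' κ αW' sW') :
    ∀ t ∈ Set.Icc (0 : ℝ) 1, IsGramBoundedR (Cc + t • (Cf - Cc)) (3 * κ) := by
  intro t ht
  have h := gramPath_of_scaleCovData hc hf t ht
  have h3 : κ + (κ + κ) = 3 * κ := by ring
  rwa [h3] at h

/-! ## §2 The tower hypothesis gives the V17F2 history at the last index -/

/-- **`TowerP ⇒ HistP … 0 (n_β + 1)`** at every `L ≥ Lstar`, `M ≥ Mstar L` (the V17F2 slots ignore the dummy frame argument). [folklore] -/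
theorem histP_top_of_towerP {G : GeoConsts} {P : SplitConsts} {Q : EngConsts} {R : RenConsts} {β U μ : ℝ} {K : TrigPolyC4v} {Lstar : ℕ}
    {Mstar : ℕ → ℕ} (hT : TowerP klPredsV17F2 G P Q R β U μ K Lstar Mstar) {L M : ℕ} [NeZero L] [NeZero M] (hL : Lstar ≤ L) (hM : Mstar L ≤ M) :
    HistP klPredsV17F2 L M G P Q R β U μ 0 (nScales β + 1) := by
  refine (histP_klPredsV17F2_iff L M G P Q R β U μ 0 (nScales β + 1)).2 fun j hj => ?_
  obtain ⟨hren, hspl, heng, htwo⟩ := (hT L M hL hM).1 j (Nat.le_of_lt_succ hj)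
  exact ⟨hspl, hren, heng, htwo⟩

/-! ## §3 The constants' laws -/

/-- The doors' Gram constant under ONE `κ`-law: `√(Cκ·(Λ_k/Λ_{k+2})·(klE0·8^{−k})) ≤ √(k₀²·8^{−k})` once `16·Cκ·klE0 ≤ k₀²`. [folklore] -/
theorem sqrt_gram_door_le {Cκ k₀ : ℝ} (hk₀ : 16 * Cκ * klE0 ≤ k₀ ^ 2) (k : ℕ) :
    Real.sqrt (Cκ * (klScale klE0 k / klScale klE0 (k + 2)) * (klE0 * ((8 : ℝ) ^ k)⁻¹)) ≤ Real.sqrt (k₀ ^ 2 * ((8 : ℝ) ^ k)⁻¹) := by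
  refine Real.sqrt_le_sqrt ?_
  rw [klScale_div_klScale_add_two]
  have h8 : 0 ≤ ((8 : ℝ) ^ k)⁻¹ := by positivity
  calc Cκ * 16 * (klE0 * ((8 : ℝ) ^ k)⁻¹) = 16 * Cκ * klE0 * ((8 : ℝ) ^ k)⁻¹ := by ring
    _ ≤ k₀ ^ 2 * ((8 : ℝ) ^ k)⁻¹ := mul_le_mul_of_nonneg_right hk₀ h8

/-- The doors' row constant under ONE `aW`-law: `Cα·(M/β)/Λ_{k+2} ≤ a₀·4^k/ε_M` (`ε_M = β/(2M)`) once `8·Cα/klE0 ≤ a₀`. [folklore] -/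
theorem row_door_le {Cα a₀ β : ℝ} {M : ℕ} (ha₀ : 8 * Cα / klE0 ≤ a₀) (hβ : 0 < β) (hM : 0 < (M : ℝ)) (k : ℕ) :
    Cα * ((M : ℝ) / β) / klScale klE0 (k + 2) ≤ a₀ * (4 : ℝ) ^ k / imagTimeWeight β M := by
  have he : (0 : ℝ) < klE0 := by norm_num [klE0]
  have hε : imagTimeWeight β M = β / (2 * M) := rfl
  have hΛ : klScale klE0 (k + 2) = klE0 * ((4 : ℝ) ^ (k + 2))⁻¹ := rfl
  rw [hε, hΛ, pow_add]
  rw [div_le_div_iff₀ (by positivity) (by positivity)]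
  have h4 : (0 : ℝ) ≤ (4 : ℝ) ^ k := by positivity
  have ha : 8 * Cα ≤ a₀ * klE0 := by rwa [div_le_iff₀ he] at ha₀
  -- `Cα·(M/β)·(β/(2M)) = Cα/2` and `a₀·4^k·(klE0·(4^k·16)⁻¹) = a₀·klE0/16`
  have hl : Cα * ((M : ℝ) / β) * (β / (2 * M)) = Cα / 2 := by field_simp
  have hr : a₀ * (4 : ℝ) ^ k * (klE0 * ((4 : ℝ) ^ k * (4 : ℝ) ^ 2)⁻¹) = a₀ * klE0 / 16 := by field_simp; ring
  rw [hl, hr]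
  linarith

/-- `Λ ≤ Λ_{n+1}` and `k + 2 ≤ n + 1` give `Λ ≤ Λ_{k+2}`; `j ≤ n` gives `Λ ≤ Λ_j`. [folklore] -/
theorem le_klScale_of_le_klScale_succ {Λ : ℝ} {n i : ℕ} (hΛ : Λ ≤ klScale klE0 (n + 1)) (hi : i ≤ n + 1) : Λ ≤ klScale klE0 i :=
  hΛ.trans (klScale_le_klScale (by norm_num [klE0]) hi)

/-! ## §4 The five door families under the tower hypothesis -/

set_option maxHeartbeats 3200000 in -- three long-binder doors instantiated five times
/-- **p3's ALL-STEPS DOORS UNDER THE TOWER HYPOTHESIS, in the shapes of `exists_towerDataTS_of_readouts`' binder block `hinst`** (see the module docstring).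
[cite: BenfattoGiulianiMastropietro2006, §2.7 (2.70)–(2.71a), §2.8 (2.80)–(2.81), §3 (3.2)–(3.8)] -/
theorem towerDoors_of_towerP :
    ∃ k₁ a₁ s₁ e₁ w₁ ρ : ℝ, 0 < k₁ ∧ 0 < a₁ ∧ 0 < s₁ ∧ 0 < e₁ ∧ 1 ≤ w₁ ∧ 0 < ρ ∧
      ∀ (G : GeoConsts) (P : SplitConsts) (Q : EngConsts) (R : RenConsts) (c : ℝ), P.WF → R.WF2 → 0 < c → c ≤ klEngC₃6 P R →
      ∀ μ ∈ klWindowC, ∀ U : ℝ, 0 < U → U ≤ min (klEngU₀3 P R c) (1 / (R.Gfr 3 + 1)) → U ≤ klEngU₀4 P R c →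
      ∀ β : ℝ, klBetaMin ≤ β → β ≤ Real.exp (c / U ^ 2) →
      ∀ (K : TrigPolyC4v) (Lstar : ℕ) (Mstar : ℕ → ℕ), TowerP klPredsV17F2 G P Q R β U μ K Lstar Mstar →
      ∀ Λ : ℝ, 0 ≤ Λ → Λ ≤ klScale klE0 (nScales β + 1) → Λ * (4 : ℝ) ^ (nScales β + 1) ≤ ρ →
      ∀ (L b M : ℕ) [NeZero L] [NeZero (b * L)] [NeZero M], Lstar ≤ L → klEngL₃ β U ≤ L → Mstar L ≤ M → Mstar (b * L) ≤ M →
        klEngM₃ β U L ≤ M → klEngM₃ β U (b * L) ≤ M →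
        (∀ j, 1 ≤ j → j < nScales β →
          ScaleCovData (klStepCov L M β μ (klFlowFrameU L M β U μ (nScales β + 1)) j) Λ (Real.sqrt (k₁ ^ 2 * ((8 : ℝ) ^ j)⁻¹))
            (a₁ * (4 : ℝ) ^ j / imagTimeWeight β M) s₁) ∧
        (∀ j, 1 ≤ j → j < nScales β →
          ScaleCovData (klStepCov (b * L) M β μ (klFlowFrameU (b * L) M β U μ (nScales β + 1)) j) Λ (Real.sqrt (k₁ ^ 2 * ((8 : ℝ) ^ j)⁻¹))
            (a₁ * (4 : ℝ) ^ j / imagTimeWeight β M) s₁) ∧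
        (∀ j, 1 ≤ j → j < nScales β →
          ScaleCovData (klStepCov (b * L) M β μ (klFlowFrameU L M β U μ (nScales β + 1)) j) Λ (Real.sqrt (k₁ ^ 2 * ((8 : ℝ) ^ j)⁻¹))
            (a₁ * (4 : ℝ) ^ j / imagTimeWeight β M) s₁) ∧
        (∀ j, 1 ≤ j → j < nScales β →
          ScaleCovSecData (klStepCov (b * L) M β μ (klFlowFrameU L M β U μ (nScales β + 1)) j) Λ e₁) ∧
        (∀ j, j ≤ nScales β →
          TransferWtData (klTowerTransfer (b * L) M β μ (klFlowFrameU L M β U μ (nScales β + 1)) j)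
            (klBlockEquivD L b M j) (klBlockEquivD L b M (j - 1)) Λ w₁) := by
  obtain ⟨Cκ, Cα, ρc, hCκ, hCα, hρc, hcov⟩ := scaleCovData_klStepCov_flow_all 10 le_rfl
  obtain ⟨Ce, ρe, hCe, hρe, hsec⟩ := scaleCovSecData_klStepCov_flow_all 10 le_rfl
  obtain ⟨Cw, ρt, hCw, hρt, htr⟩ := transferWtData_klTowerTransfer_flow_all 5 le_rfl
  have he : (0 : ℝ) < klE0 := by norm_num [klE0]
  -- the merged constants: `k₁² = 16·Cκ·klE0`, `a₁ = 8·Cα/klE0`, `s₁ = 16·Cκ·klE0`, `e₁ = Ce`, `w₁ = Cw`, `ρ = min ρc (min ρe ρt)`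
  refine ⟨Real.sqrt (16 * Cκ * klE0), 8 * Cα / klE0, 16 * Cκ * klE0, Ce, Cw, min ρc (min ρe ρt), Real.sqrt_pos.2 (by positivity), by positivity,
    by positivity, hCe, hCw, lt_min hρc (lt_min hρe hρt), ?_⟩
  intro G P Q R c hP hR2 hc hc6 μ hμ U hU hU3 hU4 β hβmin hβc K Lstar Mstar hT Λ hΛ0 hΛle hΛρ L b M _ _ _ hLs hL3 hMs hMsb hM3 hM3b
  have hβ : 0 < β := KLRegimeSplit.pos_of_klBetaMin_le hβmin
  have hk₁ : 16 * Cκ * klE0 ≤ Real.sqrt (16 * Cκ * klE0) ^ 2 := by rw [Real.sq_sqrt (by positivity)]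
  have ha₁ : 8 * Cα / klE0 ≤ 8 * Cα / klE0 := le_rfl
  have hMβ : β ≤ (M : ℝ) := le_of_klEngM₃_le hβmin hL3 hM3
  have hM0 : (0 : ℝ) < M := lt_of_lt_of_le hβ hMβ
  have hb1 : 1 ≤ b := Nat.pos_of_ne_zero fun hb => NeZero.ne (b * L) (by rw [hb, Nat.zero_mul])
  have hLbL : L ≤ b * L := Nat.le_mul_of_pos_left L hb1
  have hLsb : Lstar ≤ b * L := hLs.trans hLbL
  have hL3b : klEngL₃ β U ≤ b * L := hL3.trans hLbL
  have hnN : nScales β + 1 ≤ nScales β + 1 := le_rfl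
  have hn1 : 1 ≤ nScales β + 1 := Nat.le_add_left 1 _
  -- the histories at the two volumes
  have hhist : HistP klPredsV17F2 L M G P Q R β U μ 0 (nScales β + 1) := histP_top_of_towerP hT hLs hMs
  have hhistb : HistP klPredsV17F2 (b * L) M G P Q R β U μ 0 (nScales β + 1) := histP_top_of_towerP hT hLsb hMsb
  -- rate conditions
  have hΛρc : Λ * (4 : ℝ) ^ (nScales β + 1) ≤ ρc := hΛρ.trans (min_le_left _ _)
  have hΛρe : Λ * (4 : ℝ) ^ (nScales β + 1) ≤ ρe := hΛρ.trans ((min_le_right _ _).trans (min_le_left _ _))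
  have hΛρt : Λ * (4 : ℝ) ^ (nScales β + 1) ≤ ρt := hΛρ.trans ((min_le_right _ _).trans (min_le_right _ _))
  have hΛk : ∀ j, j < nScales β → Λ ≤ klScale klE0 (j + 2) := fun j hj => le_klScale_of_le_klScale_succ hΛle (by omega)
  -- the conversion of one door output
  have hconv : ∀ {V : ℕ} [NeZero V] {Kx : TrigPolyC4v} (j : ℕ),
      ScaleCovData (klStepCov V M β μ Kx j) Λ (Real.sqrt (Cκ * (klScale klE0 j / klScale klE0 (j + 2)) * (klE0 * ((8 : ℝ) ^ j)⁻¹)))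
        (Cα * ((M : ℝ) / β) / klScale klE0 (j + 2)) (16 * Cκ * klE0) →
      ScaleCovData (klStepCov V M β μ Kx j) Λ (Real.sqrt (Real.sqrt (16 * Cκ * klE0) ^ 2 * ((8 : ℝ) ^ j)⁻¹))
        (8 * Cα / klE0 * (4 : ℝ) ^ j / imagTimeWeight β M) (16 * Cκ * klE0) :=
    fun j h => scaleCovData_mono' h (sqrt_gram_door_le hk₁ j) (row_door_le ha₁ hβ hM0 j) le_rfl
  refine ⟨fun j hj1 hjN => hconv j ?_, fun j hj1 hjN => hconv j ?_, fun j hj1 hjN => hconv j ?_, fun j hj1 hjN => ?_, fun j hjN => ?_⟩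
  · -- coarse volume, own frame
    exact hcov G P R Q c hP hR2 hc hc6 μ hμ U hU hU3 hU4 β hβmin hβc L M hL3 hM3 (nScales β + 1) hn1 hnN hhist L hL3 hM3 j hj1 (by omega)
      Λ hΛ0 (hΛk j hjN) hΛρc
  · -- fine volume, own frame
    exact hcov G P R Q c hP hR2 hc hc6 μ hμ U hU hU3 hU4 β hβmin hβc (b * L) M hL3b hM3b (nScales β + 1) hn1 hnN hhistb (b * L) hL3b hM3b j hj1
      (by omega) Λ hΛ0 (hΛk j hjN) hΛρc
  · -- fine volume, coarse frame
    exact hcov G P R Q c hP hR2 hc hc6 μ hμ U hU hU3 hU4 β hβmin hβc L M hL3 hM3 (nScales β + 1) hn1 hnN hhist (b * L) hL3b hM3b j hj1 (by omega)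
      Λ hΛ0 (hΛk j hjN) hΛρc
  · -- sectional row, fine volume, coarse frame
    exact hsec G P R Q c hR2 hc hc6 μ hμ U hU hU3 β hβmin hβc L M hL3 hM3 (nScales β + 1) hn1 hnN hhist (b * L) hL3b j hj1 (by omega)
      Λ hΛ0 (hΛk j hjN) hΛρe
  · -- transfer, fine volume, coarse frame
    exact htr G P R Q c hR2 hc hc6 μ hμ U hU hU3 β hβmin hβc L M hL3 hM3 (nScales β + 1) hn1 hnN hhist b hL3b j (by omega) Λ hΛ0
      (le_klScale_of_le_klScale_succ hΛle (by omega)) hΛρt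

end Summit.HubbardSuperconductivity.HubbardSuperconductivity.Theorems.TwoVolumeSource

end
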